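import Summits.QuantumFields.BalabanUV.Beta.D1BFx.CombFPWordArrays
import Summits.QuantumFields.BalabanUV.Beta.GAN24.CoDressedColumnPairing
import Summits.QuantumFields.BalabanUV.Beta.BorderedHessianBlind
import Summits.QuantumFields.BalabanUV.Beta.AxialDressingRootedReflection

/-!
# `BalabanUV.Beta.D1BFx.BondTreeGaugeSharp` — road «BF-x» for binder row D1, slot (K), DICT-CHAIN-SPEC §2 (II) row RK-FP: **«BMF-SHARP» — THE ROOTED
# TREE INTEGRAL OF A BOND INDICATOR IS `0` OR `±1`, SO THE BLOCK-MEAN-FREE COMB GAUGE FUNCTION OF A FINE BOND IS BOUNDED BY `2`** (any root, any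
# dimension, any block side): `|treeGaugeAt ρ (bondInd α q) N x| ≤ 1`, `|bmGaugeAt ρ (delta1 β X) N w| ≤ 2`, and the sharp twin of
# `CombFPWordArrays.biLoc_nFcol`: `BiLoc (nFcol r n κ u) u (u + e_κ) (2·e^{4nδ}) δ` — the comb-FP words' letter WITHOUT the contour length `2(d+1)n`

HONEST DEPENDENCY (cell records, verbatim): «continuum YM on T⁴ ⇐ BetaPertH ∧ nine spine estimates (0/9 proved); BetaPertH ⇐ (D1) ∧ (D4) ∧
CAP+tail; G-an2-4 gates asym, D1 and NE2/3/4.»  HONEST FRAMING (cell contract, verbatim): «discharging `BetaPertH` makes Bałaban's UV stability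
UNCONDITIONAL — a real constructive-QFT result; it is NOT the continuum limit and NOT the Clay problem.»  THIS MODULE DISCHARGES NOTHING of the
wall: [folklore] lattice bookkeeping over node 5's axial contours (`AveragingContours.seg ∕ axialAux ∕ axial ∕ seg_sum_grad`), an2's rooted tree gauge
(`AveragingContoursRooted.treeGaugeAt`, `AxialDressingRooted.bondInd`, `AxialDressingRootedReflection.treeGaugeAt_map`, `AxialProjectorBlockMean.bmGaugeAt`),
gan24-leaf-02's `CoDressedColumnPairing.abs_blockMeanAt_le`, and leaf-03's comb-FP family `CombFPWordArrays.nFcol` (`nFcol_apply`, `nFcol_eq_zero_of_far`,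
`l1_le_of_abs_lt`) BY NAME.  No definition, no `def … : Prop`, nothing cited, 0 sorry.  NO (1.22) unit row is proved here (RK-FP is d1-leaf-04's);
0 root-level binders of row D1 discharged (hW ∕ hR-sockets ∕ hSX-socket ∕ D1Tel ∕ D1Rep = 0); (K) NOT closed; NOT D1, NOT `BetaPertH`, NOT continuum, NOT Clay.

ABSOLUTE RULE (cell charter, verbatim): «No internally-minted statement may enter as a cited fact. Every hypothesis is either kernel-proved in
this package or a verbatim quotation of a PUBLISHED theorem with page reference. The manuscript(s) under audit are NOT citable for their own
disputed steps — they are the thing under adjudication; programme-internal (2001/route/tribunal) claims are never citable.»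

WHY (d1-leaf-04 g20's INTENT 1 «RK-FP UNIT» `RestKernelFPUnit` l.42232: the comb-FP rest word `2·hessKer idK1 𝒳 𝒳₂` of PART 7∕8 is a (5.10)-kernel with
constant `Kfp = 32·n·C²·Zl 4 (δ∕2) + (32·n·C·e^{(δ∕2)(4n+1)})²·Zl 4 (δ∕4)²` for weights with envelope `C·e^{−δ|u − n•v|₁}`, whence «unit class iff `C = O(n⁻⁵)`»;
this lineage's «G0-COL-ENV» (`PackedColumnEnvelope`) supplies `C = (n⁴)⁻¹·C_{G₀}` for the road's gauged weights `colH G₀ n` — ONE power short).  The `32·n`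
is `4 × 2(d+1)n` from leaf-03's `TorusGaugeBasisMatrix.abs_bmF_le`, the bound of the rooted tree integral of a bond indicator by the contour LENGTH.  But the
axial contour is a concatenation of straight segments, one per axis; only the segment along the bond's own axis can meet the bond, and along that segment
the bond indicator IS an exact gradient (of the indicator of the half-line beyond the bond), so the segment sum telescopes to a difference of two values in
`{0, 1}`: the tree integral is `0` or `±1`, its block mean lies in `[−1, 1]`, and `|bmF| ≤ 2`.  With `Λ = 2` for `8n` leaf-04's constant reads
`Kfp♯ = 8·C²·Zl 4 (δ∕2) + (8·C·e^{(δ∕2)(4n+1)})²·Zl 4 (δ∕4)²`, i.e. «unit class iff `C = O(n⁻⁴)`» — met by «G0-COL-ENV».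

CONTENT.
* §1 [folklore, generic dimension `d`, integer forms]: `sum_seg_of_eq_grad` (a segment along `κ` of a form agreeing with `grad f` in direction `κ`
  telescopes), `bondInd_self_eq_grad` (along its own axis the bond indicator is the gradient of the half-line indicator, written inline),
  `sum_seg_bondInd_of_ne` (segments along other axes read zero), `abs_sum_seg_bondInd_le_one`, `sum_axialAux_bondInd_eq_zero` (axes below the bond's own
  contribute nothing), `abs_sum_axialAux_bondInd_le_one`, **`abs_treeGaugeAt_bondInd_le_one (ρ α q N x) : |treeGaugeAt ρ (bondInd α q) N x| ≤ 1`** — ANY root.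
* §2 [folklore, dimension `d + 1`, real forms] `abs_treeGaugeAt_delta1_le_one`, **`abs_bmGaugeAt_delta1_le_two (hN : 1 ≤ N) (ρ β X w) : |bmGaugeAt ρ (delta1 β X) N w| ≤ 2`**
  (the sharp form of leaf-03's `abs_bmF_le`, whose right side is `2·(d+1)·n`).
* §3 [folklore, `d = 3`, the road's comb-FP family] **`biLoc_nFcol_sharp (hr : r ∈ box 4 n) (hδ : 0 ≤ δ) : BiLoc (nFcol r n κ u) u (u + e_κ) (2·e^{δ·4n}) δ`**
  (leaf-03's `biLoc_nFcol` proof verbatim with §2 for `abs_bmF_le`; the block support `nFcol_eq_zero_of_far` still needs the in-block root).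
NOT HERE (honest): the RK-FP row and its constants (d1-leaf-04's `RestKernelFPUnit`, their lane: with `Λ = 2` their `Kfp` loses the factor `(4n)²`); anything
about Bałaban's tables.
Unit `b2b-balaban-gan24-formalise-leaf-05` (gen 53), G-an2-4 swarm leaf prover 05, road «BF-x» supplier; OFFER O-gan24leaf05-g53-1 «BMF-SHARP» (journal).
-/

noncomputable section

open Finset
open scoped BigOperators
open Literature.MathematicalPhysics.QuantumFieldTheory
open Literature.MathematicalPhysics.QuantumFieldTheory.Balaban1983to89
open Literature.MathematicalPhysics.QuantumFieldTheory.Balaban1983to89.Beta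
open B12Sec2to5 (l1 l1_nonneg)
open ExpKernelCalculus (MKer BiLoc)
open AffineAveraging (Site Form0 Form1 box toSite unitVec unitVec_apply)
open AveragingContours (grad seg segUp segDown axialAux axial seg_sum_grad blk)
open AveragingContoursRooted (treeGaugeAt)
open KKTFluctuationKernel (delta1)
open Summit.QuantumFields.BalabanUV.Beta.AxialDressingRooted (bondInd bondInd_apply)
open Summit.QuantumFields.BalabanUV.Beta.AxialDressingRooted (treeGaugeAt_map)
open Summit.QuantumFields.BalabanUV.Beta.AxialProjectorBlockMean (blockMeanAt bmGaugeAt)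
open Summit.QuantumFields.BalabanUV.Beta.BorderedHessian (bondInd_cast_eq_delta1)
open Summit.QuantumFields.BalabanUV.Beta.GAN24.CoDressedColumnPairing (abs_blockMeanAt_le)
open Summit.QuantumFields.BalabanUV.Beta.D1BFx.CombFPWordArrays (nFcol nFcol_apply nFcol_eq_zero_of_far l1_le_of_abs_lt)
open Summit.QuantumFields.BalabanUV.Beta.D1BFx.GhostStencil (l1_zero)

namespace Summit.QuantumFields.BalabanUV.Beta.D1BFx.BondTreeGaugeSharp

/-! ## §1 Integer forms, any dimension: the tree integral of a bond indicator is `0` or `±1` -/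

section IntForms

variable {d : ℕ}

/-- [folklore] A straight segment reads the form only in its own direction: if `A κ = (grad f) κ` then the segment along `κ` telescopes,
`(seg A z κ t).sum = f (z + t•e_κ) − f z` (node 5's `seg_sum_grad`). -/
theorem sum_seg_of_eq_grad {A : Form1 d ℤ} {f : Site d → ℤ} {κ : Fin d} (h : A κ = grad f κ) (z : Site d) (t : ℤ) :
    (seg A z κ t).sum = f (z + t • unitVec κ) - f z := by
  have e : seg A z κ t = seg (grad f) z κ t := by
    unfold AveragingContours.seg AveragingContours.segUp AveragingContours.segDown
    simp only [h]
  rw [e, seg_sum_grad]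

/-- [folklore] **ALONG ITS OWN AXIS THE BOND INDICATOR IS AN EXACT GRADIENT** — of the indicator `f` of the open half-line `{q + s•e_α : s ≥ 1}`
(`f p = 1` iff `p` agrees with `q` off `α` and `q_α < p_α`): `bondInd α q α = (grad f) α`.  (`f` is a proof device, written inline — no definition.) -/
theorem bondInd_self_eq_grad (α : Fin d) (q : Site d) :
    bondInd α q α = grad (fun p : Site d => if (∀ j, j ≠ α → p j = q j) ∧ q α < p α then (1 : ℤ) else 0) α := by
  funext p
  simp only [bondInd_apply, true_and]
  unfold AveragingContours.grad
  beta_reduce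
  have hoff : (∀ j, j ≠ α → (p + unitVec α) j = q j) ↔ (∀ j, j ≠ α → p j = q j) := by
    refine forall_congr' fun j => ?_
    refine imp_congr_right fun hj => ?_
    rw [Pi.add_apply, unitVec_apply, if_neg hj, add_zero]
  have hα : (p + unitVec α) α = p α + 1 := by rw [Pi.add_apply, unitVec_apply, if_pos rfl]
  have key : ((∀ j, j ≠ α → (p + unitVec α) j = q j) ∧ q α < (p + unitVec α) α) ↔ ((∀ j, j ≠ α → p j = q j) ∧ q α < p α + 1) := by
    rw [hα]; exact and_congr hoff Iff.rfl
  rw [if_congr key rfl rfl]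
  by_cases hP : ∀ j, j ≠ α → p j = q j
  · have hpq : p = q ↔ p α = q α := by
      constructor
      · intro h; rw [h]
      · intro h; funext j; by_cases hj : j = α
        · rw [hj]; exact h
        · exact hP j hj
    rw [if_congr hpq rfl rfl, if_congr (and_iff_right hP) rfl rfl, if_congr (and_iff_right hP) rfl rfl]
    split_ifs <;> omega
  · have hne : ¬ p = q := fun h => hP fun j _ => by rw [h]
    have h1 : ¬ ((∀ j, j ≠ α → p j = q j) ∧ q α < p α + 1) := fun h => hP h.1
    have h2 : ¬ ((∀ j, j ≠ α → p j = q j) ∧ q α < p α) := fun h => hP h.1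
    rw [if_neg hne, if_neg h1, if_neg h2, sub_zero]

/-- [folklore] **SEGMENTS ALONG OTHER AXES READ ZERO**: for `κ ≠ α`, `(seg (bondInd α q) z κ t).sum = 0`. -/
theorem sum_seg_bondInd_of_ne {α κ : Fin d} (hκ : κ ≠ α) (q z : Site d) (t : ℤ) : (seg (bondInd α q) z κ t).sum = 0 := by
  have h : bondInd α q κ = grad (fun _ : Site d => (0 : ℤ)) κ := by
    funext p
    rw [bondInd_apply, if_neg (fun h => hκ h.1)]
    unfold AveragingContours.grad
    simp
  rw [sum_seg_of_eq_grad h z t, sub_self]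

/-- [folklore] **ONE SEGMENT MEETS A BOND AT MOST ONCE**: `|(seg (bondInd α q) z κ t).sum| ≤ 1` (along `α` the sum telescopes to a difference of two
values of the half-line indicator, both in `{0, 1}`; along `κ ≠ α` it vanishes). -/
theorem abs_sum_seg_bondInd_le_one (α κ : Fin d) (q z : Site d) (t : ℤ) : |(seg (bondInd α q) z κ t).sum| ≤ 1 := by
  by_cases hκ : κ = α
  · subst hκ
    rw [sum_seg_of_eq_grad (bondInd_self_eq_grad κ q) z t]
    beta_reduce
    split_ifs <;> simp
  · rw [sum_seg_bondInd_of_ne hκ, abs_zero]; exact zero_le_one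

/-- [folklore] **THE AXES BELOW THE BOND's OWN CONTRIBUTE NOTHING**: for `m ≤ α`, `(axialAux (bondInd α q) y x m).sum = 0` (the partial contour `axialAux … m`
moves the coordinates `m−1, …, 0`, all different from `α`). -/
theorem sum_axialAux_bondInd_eq_zero (α : Fin d) (q y x : Site d) : ∀ {m : ℕ}, m ≤ (α : ℕ) → (axialAux (bondInd α q) y x m).sum = 0
  | 0, _ => rfl
  | m + 1, hm => by
    have hm' : m ≤ (α : ℕ) := Nat.le_of_succ_le hm
    rw [AveragingContours.axialAux, List.sum_append, sum_axialAux_bondInd_eq_zero α q y x hm', add_zero]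
    split
    · next h =>
      have hne : (⟨m, h⟩ : Fin d) ≠ α := fun e => by
        have := congrArg Fin.val e; simp only at this; omega
      exact sum_seg_bondInd_of_ne hne q _ _
    · rfl

/-- [folklore] **THE PARTIAL CONTOURS MEET A BOND AT MOST ONCE**: `|(axialAux (bondInd α q) y x m).sum| ≤ 1` for every `m`. -/
theorem abs_sum_axialAux_bondInd_le_one (α : Fin d) (q y x : Site d) : ∀ m : ℕ, |(axialAux (bondInd α q) y x m).sum| ≤ 1
  | 0 => by rw [show axialAux (bondInd α q) y x 0 = [] from rfl, List.sum_nil, abs_zero]; exact zero_le_one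
  | m + 1 => by
    rw [AveragingContours.axialAux, List.sum_append]
    split
    · next h =>
      by_cases hm : m = (α : ℕ)
      · -- the bond's own axis: the segment reads at most one crossing, the lower axes read zero
        rw [sum_axialAux_bondInd_eq_zero α q y x hm.le, add_zero]
        exact abs_sum_seg_bondInd_le_one α ⟨m, h⟩ q _ _
      · have hne : (⟨m, h⟩ : Fin d) ≠ α := fun e => hm (by rw [← e])
        rw [sum_seg_bondInd_of_ne hne, zero_add]
        exact abs_sum_axialAux_bondInd_le_one α q y x m
    · rw [List.sum_nil, zero_add]
      exact abs_sum_axialAux_bondInd_le_one α q y x m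

/-- [folklore] **THE AXIAL CONTOUR MEETS A BOND AT MOST ONCE**: `|(axial (bondInd α q) y x).sum| ≤ 1`. -/
theorem abs_sum_axial_bondInd_le_one (α : Fin d) (q y x : Site d) : |(axial (bondInd α q) y x).sum| ≤ 1 :=
  abs_sum_axialAux_bondInd_le_one α q y x d

/-- [folklore] **«BMF-SHARP», INTEGER FORM: THE ROOTED TREE INTEGRAL OF A BOND INDICATOR IS `0` OR `±1`** — `|treeGaugeAt ρ (bondInd α q) N x| ≤ 1`
for EVERY root `ρ`, block side `N` and site `x` (no in-block hypothesis; compare an2's `abs_treeGaugeAt_bondInd_le`: `≤ n·N`). -/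
theorem abs_treeGaugeAt_bondInd_le_one (ρ : Site d) (α : Fin d) (q : Site d) (N : ℕ) (x : Site d) :
    |treeGaugeAt ρ (bondInd α q) N x| ≤ 1 := by
  unfold treeGaugeAt
  exact abs_sum_axial_bondInd_le_one α q _ x

end IntForms

/-! ## §2 Real forms, dimension `d + 1`: `|bmGaugeAt ρ (delta1 β X) N w| ≤ 2` -/

section RealForms

variable {d : ℕ}

/-- [folklore] The real tree integral of lit-balaban's real bond indicator `delta1 β X` is the cast of the integer one, hence `≤ 1` in absolute value. -/
theorem abs_treeGaugeAt_delta1_le_one (ρ : Fin (d + 1) → ℤ) (β : Fin (d + 1)) (X : Fin (d + 1) → ℤ) (N : ℕ) (w : Fin (d + 1) → ℤ) :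
    |treeGaugeAt ρ (delta1 β X) N w| ≤ 1 := by
  rw [← bondInd_cast_eq_delta1 β X]
  have h := treeGaugeAt_map (Int.castAddHom ℝ) ρ (bondInd β X) N w
  simp only [Int.coe_castAddHom] at h
  rw [h]
  have h1 := abs_treeGaugeAt_bondInd_le_one ρ β X N w
  have h2 : ((|treeGaugeAt ρ (bondInd β X) N w| : ℤ) : ℝ) ≤ ((1 : ℤ) : ℝ) := by exact_mod_cast h1
  rw [Int.cast_abs, Int.cast_one] at h2
  exact h2

/-- [folklore] **«BMF-SHARP»: THE BLOCK-MEAN-FREE COMB GAUGE FUNCTION OF A FINE BOND IS BOUNDED BY `2`** — `|bmGaugeAt ρ (delta1 β X) N w| ≤ 2` for every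
root, block side `N ≥ 1`, bond `(β, X)` and site `w` (the tree integral is `≤ 1`, its block mean is `≤ 1`; the sharp form of leaf-03's
`TorusGaugeBasisMatrix.abs_bmF_le`, whose bound is the contour length `2·(d+1)·n`). -/
theorem abs_bmGaugeAt_delta1_le_two {N : ℕ} (hN : 1 ≤ N) (ρ : Fin (d + 1) → ℤ) (β : Fin (d + 1)) (X : Fin (d + 1) → ℤ)
    (w : Fin (d + 1) → ℤ) : |bmGaugeAt ρ (delta1 β X) N w| ≤ 2 := by
  unfold bmGaugeAt
  rw [Pi.sub_apply]
  have h1 := abs_treeGaugeAt_delta1_le_one ρ β X N w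
  have h2 : |blockMeanAt N (treeGaugeAt ρ (delta1 β X) N) w| ≤ 1 :=
    abs_blockMeanAt_le hN (fun x => abs_treeGaugeAt_delta1_le_one ρ β X N x) w
  calc |treeGaugeAt ρ (delta1 β X) N w - blockMeanAt N (treeGaugeAt ρ (delta1 β X) N) w|
      ≤ |treeGaugeAt ρ (delta1 β X) N w| + |blockMeanAt N (treeGaugeAt ρ (delta1 β X) N) w| := abs_sub _ _
    _ ≤ 1 + 1 := add_le_add h1 h2
    _ = 2 := by norm_num

end RealForms

/-! ## §3 The road's comb-FP family: the sharp localisation letter -/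

section CombFP

variable {r : Fin (3 + 1) → ℕ} {n : ℕ} [NeZero n] (κ : Fin 4) (u : Fin 4 → ℤ)

/-- [folklore] **THE SHARP LOCALISATION OF THE COMB-FP WORDS**: `BiLoc (nFcol κ u) u (u + e_κ) (2·e^{δ·4n}) δ` for every `δ ≥ 0` and every in-block root
(leaf-03's `CombFPWordArrays.biLoc_nFcol` with «BMF-SHARP» in place of `abs_bmF_le`: the constant `2·(3+1)·n` becomes `2`; the window factor `e^{4nδ}` is the
price of re-centring a block-supported column, `n`-uniform for `δ ≲ 1∕n`). -/
theorem biLoc_nFcol_sharp (hr : r ∈ box (3 + 1) n) {δ : ℝ} (hδ : 0 ≤ δ) :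
    BiLoc (nFcol r n κ u) u (u + unitVec κ) (2 * Real.exp (δ * (4 * n))) δ := by
  intro x y a b
  by_cases hy : y = u + unitVec κ
  · by_cases hx : ∀ j, |x j - u j| < (n : ℤ)
    · have hl := l1_le_of_abs_lt (n := n) hx
      rw [nFcol_apply, if_pos hy, mul_one, hy, sub_self, l1_zero, add_zero]
      calc |bmGaugeAt (toSite r) (delta1 κ u) n x| ≤ 2 := abs_bmGaugeAt_delta1_le_two (NeZero.one_le (n := n)) (toSite r) κ u x
        _ = 2 * (Real.exp (δ * (4 * n)) * Real.exp (-(δ * (4 * n)))) := by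
            rw [← Real.exp_add, add_neg_cancel, Real.exp_zero, mul_one]
        _ ≤ 2 * (Real.exp (δ * (4 * n)) * Real.exp (-δ * l1 (x - u))) := by
            refine mul_le_mul_of_nonneg_left (mul_le_mul_of_nonneg_left (Real.exp_le_exp.mpr ?_) (Real.exp_pos _).le) (by norm_num)
            nlinarith
        _ = 2 * Real.exp (δ * (4 * n)) * Real.exp (-δ * l1 (x - u)) := by ring
    · obtain ⟨j, hj⟩ := not_forall.mp hx
      rw [nFcol_eq_zero_of_far κ u hr (not_lt.mp hj) y a b, abs_zero]
      positivity
  · rw [nFcol_apply, if_neg hy, mul_zero, abs_zero]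
    positivity

end CombFP

end Summit.QuantumFields.BalabanUV.Beta.D1BFx.BondTreeGaugeSharp

end
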